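import Mathlib
import HarnessLib
import Summits.NavierStokesRegularity.NavierStokesRegularity.Theorems.PoloidalWindowDoorLrcModEntireTwistingTHLocalRotation

/-!
# Route `PoloidalWindowDoor`, crux `PoloidalWindowRigidity` (stmt-19708) / item `LrcModEntire` (stmt-20428), line `sparse_energy` —
# the SOURCE-FREE local (TH)∩twisting statement: ROTATION gauge (third normal-form step of v4.4; scaling in `…NormalFormRS`)

Seat ns-poloidal-K2-p2 g9 (successor of the interim LEAD-of-record on 19708; file `--supports`).  Continues `…TwistingTHSparseNormalForm`
(non-umbilic + Galilean): K2-p2 g8's `…TwistingTHLocalRotation.localTHEmptyHypNF_of_rotation` (p607457) and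
`…TwistingTHLocalScaling.localTHEmptyHypNFR_of_scaling` (p607864) RE-RUN WITH THE EXPLICIT DATUM TRACKED.  The source-free rest-frame datum
`A = k(∂ₜμ − ∂_z²μ) − (k²/2)∂_zμ` (one real scalar `k`) is INVARIANT under the horizontal rotation about the base point (`μ`, `A` unchanged, the
rotation fixes the height: `galileanSF_of_rotationSF`, same `k`) and COVARIANT under the parabolic scaling `(s,y) ↦ (c²s, cy)`, `u ↦ c·u`,
`μ′(s,z) = μ(c²s,cz)`, `A′ = c³A(c²s,cz)` (`rotationSF_of_scalingSF`, `k ↦ c·k`).  Hence the chain (this file + `…TwistingTHSparseNormalForm` +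
`…TwistingTHSparse`):  hemptyHypSF_NFRS ⇒ hemptyHypSF_NFR ⇒ hemptyHypSF_NUG ⇒ hemptyHypSF_NU ⇒ hemptyHypSF ⇒ `stub_hyperbolicTH` / `stub_twisting ∩ (TH)`
ON K-SPARSE PROFILES, where **hemptyHypSF_NFRS** = K2-p2 g8's `hemptyHypNFRS` (gauge of record `u(p₀) = 0`, `∂₀u₂(p₀) = 0`, `∂₁u₂(p₀) = 1`, non-umbilic,
`μ < 0`, pins) with the A-hypothesis `∃ k : ℝ, ∀ p ∈ U, A p.1 (p.2 2) = k·(∂ₜμ − ∂_z²μ)(p) − (k²/2)·∂_zμ(p)` inserted after `μ(p₀) < 0` — the v4.4 text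
`stub_localTHEmptySFRS` up to the order of binders and the spelling `∃ k` (K2-p3 may register either spelling; the sign of the `k²` term is MINUS).

WHAT THIS IS NOT: not a proof of any stub and not a claim about Navier–Stokes — two reductions (bears_on LADDER-NS N0 via 19708/20428). [folklore]
-/

noncomputable section

-- the summit and its single sub-problem share the name (CONVENTIONS §1), as in every Theorems file
set_option linter.dupNamespace false

namespace Summit.NavierStokesRegularity.NavierStokesRegularity.Theorems.PoloidalWindowDoorLrcModEntireTwistingTHSparseNormalFormR

open Set Function Filter Topology Metric
open scoped RealInnerProductSpace InnerProductSpace Laplacian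
open Literature.Analysis Literature.Analysis.FluidPDE
open Summit.NavierStokesRegularity.NavierStokesRegularity.Theorems.PoloidalWindowDoorLrcModEntireTHCertLetters
open Summit.NavierStokesRegularity.NavierStokesRegularity.Theorems.PoloidalWindowDoorLrcModEntireTHCertDictionary
open Summit.NavierStokesRegularity.NavierStokesRegularity.Theorems.PoloidalWindowDoorLrcModEntireTwistingTHLocalRotation

/-! ### Step 3: rotation gauge `∂₀u₂(p₀) = 0` (the datum is unchanged) -/

/-- **`hemptyHypSF_NUG ⇐ hemptyHypSF_NFR`** — the source-free rest-point statement may assume `∂₀u₂(p₀) = 0 < ∂₁u₂(p₀)` (horizontal rotation about `p₀`;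
p607457 verbatim, the explicit datum rides along with the same `k`). [folklore] -/
theorem galileanSF_of_rotationSF
    (hR : ∀ (u : ℝ → EuclideanSpace ℝ (Fin 3) → EuclideanSpace ℝ (Fin 3)) (μ A : ℝ → ℝ → ℝ)
      (U : Set (ℝ × EuclideanSpace ℝ (Fin 3))) (p₀ : ℝ × EuclideanSpace ℝ (Fin 3)),
      IsOpen U → p₀ ∈ U →
      AnalyticOnNhd ℝ (Function.uncurry u) U →
      (∀ p ∈ U, AnalyticAt ℝ (Function.uncurry μ) (p.1, p.2 2)) →
      (∀ p ∈ U, AnalyticAt ℝ (Function.uncurry A) (p.1, p.2 2)) →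
      (∀ p ∈ U, fderiv ℝ (u p.1) p.2 (EuclideanSpace.single 0 1) 1 = fderiv ℝ (u p.1) p.2 (EuclideanSpace.single 1 1) 0) →
      (∀ p ∈ U, fderiv ℝ (u p.1) p.2 (EuclideanSpace.single 0 1) 0 + fderiv ℝ (u p.1) p.2 (EuclideanSpace.single 1 1) 1 +
        fderiv ℝ (u p.1) p.2 (EuclideanSpace.single 2 1) 2 = 0) →
      (∀ p ∈ U, ∀ b : Fin 3, b ≠ 2 →
        fderiv ℝ (u p.1) p.2 (EuclideanSpace.single 2 1) b =
          μ p.1 (p.2 2) * fderiv ℝ (u p.1) p.2 (EuclideanSpace.single b 1) 2) →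
      (∀ p ∈ U,
        (1 - μ p.1 (p.2 2)) *
            (deriv (fun s => u s p.2 2) p.1 + fderiv ℝ (fun y => u p.1 y 2) p.2 (u p.1 p.2)
              - Δ (fun y => u p.1 y 2) p.2) =
          A p.1 (p.2 2) + (deriv (fun s => μ s (p.2 2)) p.1 - deriv (deriv (μ p.1)) (p.2 2)) * u p.1 p.2 2
            + deriv (μ p.1) (p.2 2) / 2 * u p.1 p.2 2 ^ 2
            - 2 * deriv (μ p.1) (p.2 2) * fderiv ℝ (u p.1) p.2 (EuclideanSpace.single 2 1) 2) →
      fderiv ℝ (fun y => fderiv ℝ (u p₀.1) y (EuclideanSpace.single 2 1) 2) p₀.2 (EuclideanSpace.single 0 1) *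
            fderiv ℝ (u p₀.1) p₀.2 (EuclideanSpace.single 1 1) 2 -
          fderiv ℝ (fun y => fderiv ℝ (u p₀.1) y (EuclideanSpace.single 2 1) 2) p₀.2 (EuclideanSpace.single 1 1) *
            fderiv ℝ (u p₀.1) p₀.2 (EuclideanSpace.single 0 1) 2 ≠ 0 →
      μ p₀.1 (p₀.2 2) ≠ 0 → μ p₀.1 (p₀.2 2) ≠ 1 → deriv (μ p₀.1) (p₀.2 2) ≠ 0 →
      μ p₀.1 (p₀.2 2) < 0 →
      (∃ k : ℝ, ∀ p ∈ U, A p.1 (p.2 2) =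
        k * (deriv (fun s => μ s (p.2 2)) p.1 - deriv (deriv (μ p.1)) (p.2 2)) - k ^ 2 / 2 * deriv (μ p.1) (p.2 2)) →
      (fderiv ℝ (u p₀.1) p₀.2 (EuclideanSpace.single 0 1) 0 ≠ fderiv ℝ (u p₀.1) p₀.2 (EuclideanSpace.single 1 1) 1 ∨
        fderiv ℝ (u p₀.1) p₀.2 (EuclideanSpace.single 1 1) 0 ≠ 0) →
      u p₀.1 p₀.2 = 0 →
      fderiv ℝ (u p₀.1) p₀.2 (EuclideanSpace.single 0 1) 2 = 0 →
      0 < fderiv ℝ (u p₀.1) p₀.2 (EuclideanSpace.single 1 1) 2 → False) :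
    ∀ (u : ℝ → EuclideanSpace ℝ (Fin 3) → EuclideanSpace ℝ (Fin 3)) (μ A : ℝ → ℝ → ℝ)
      (U : Set (ℝ × EuclideanSpace ℝ (Fin 3))) (p₀ : ℝ × EuclideanSpace ℝ (Fin 3)),
      IsOpen U → p₀ ∈ U →
      AnalyticOnNhd ℝ (Function.uncurry u) U →
      (∀ p ∈ U, AnalyticAt ℝ (Function.uncurry μ) (p.1, p.2 2)) →
      (∀ p ∈ U, AnalyticAt ℝ (Function.uncurry A) (p.1, p.2 2)) →
      (∀ p ∈ U, fderiv ℝ (u p.1) p.2 (EuclideanSpace.single 0 1) 1 = fderiv ℝ (u p.1) p.2 (EuclideanSpace.single 1 1) 0) →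
      (∀ p ∈ U, fderiv ℝ (u p.1) p.2 (EuclideanSpace.single 0 1) 0 + fderiv ℝ (u p.1) p.2 (EuclideanSpace.single 1 1) 1 +
        fderiv ℝ (u p.1) p.2 (EuclideanSpace.single 2 1) 2 = 0) →
      (∀ p ∈ U, ∀ b : Fin 3, b ≠ 2 →
        fderiv ℝ (u p.1) p.2 (EuclideanSpace.single 2 1) b =
          μ p.1 (p.2 2) * fderiv ℝ (u p.1) p.2 (EuclideanSpace.single b 1) 2) →
      (∀ p ∈ U,
        (1 - μ p.1 (p.2 2)) *
            (deriv (fun s => u s p.2 2) p.1 + fderiv ℝ (fun y => u p.1 y 2) p.2 (u p.1 p.2)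
              - Δ (fun y => u p.1 y 2) p.2) =
          A p.1 (p.2 2) + (deriv (fun s => μ s (p.2 2)) p.1 - deriv (deriv (μ p.1)) (p.2 2)) * u p.1 p.2 2
            + deriv (μ p.1) (p.2 2) / 2 * u p.1 p.2 2 ^ 2
            - 2 * deriv (μ p.1) (p.2 2) * fderiv ℝ (u p.1) p.2 (EuclideanSpace.single 2 1) 2) →
      fderiv ℝ (fun y => fderiv ℝ (u p₀.1) y (EuclideanSpace.single 2 1) 2) p₀.2 (EuclideanSpace.single 0 1) *
            fderiv ℝ (u p₀.1) p₀.2 (EuclideanSpace.single 1 1) 2 -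
          fderiv ℝ (fun y => fderiv ℝ (u p₀.1) y (EuclideanSpace.single 2 1) 2) p₀.2 (EuclideanSpace.single 1 1) *
            fderiv ℝ (u p₀.1) p₀.2 (EuclideanSpace.single 0 1) 2 ≠ 0 →
      μ p₀.1 (p₀.2 2) ≠ 0 → μ p₀.1 (p₀.2 2) ≠ 1 → deriv (μ p₀.1) (p₀.2 2) ≠ 0 →
      μ p₀.1 (p₀.2 2) < 0 →
      (∃ k : ℝ, ∀ p ∈ U, A p.1 (p.2 2) =
        k * (deriv (fun s => μ s (p.2 2)) p.1 - deriv (deriv (μ p.1)) (p.2 2)) - k ^ 2 / 2 * deriv (μ p.1) (p.2 2)) →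
      (fderiv ℝ (u p₀.1) p₀.2 (EuclideanSpace.single 0 1) 0 ≠ fderiv ℝ (u p₀.1) p₀.2 (EuclideanSpace.single 1 1) 1 ∨
        fderiv ℝ (u p₀.1) p₀.2 (EuclideanSpace.single 1 1) 0 ≠ 0) →
      u p₀.1 p₀.2 = 0 → False := by
  intro u μ A U p₀ hU hp₀ hu hμ hA hpol hdiv hsh hE htw hm0 hm1 hmz hneg hSF hNU hrest
  obtain ⟨t₀, x₀⟩ := p₀
  dsimp only at hp₀ htw hm0 hm1 hmz hneg hNU hrest
  -- the horizontal gradient of `u₂` at `p₀` does not vanish (twist pin); the angle of the rotation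
  set W0 : ℝ := fderiv ℝ (u t₀) x₀ (EuclideanSpace.single 0 1) 2 with hW0
  set W1 : ℝ := fderiv ℝ (u t₀) x₀ (EuclideanSpace.single 1 1) 2 with hW1
  set zc : ℂ := ⟨W1, W0⟩ with hzc
  have hz : zc ≠ 0 := by
    intro h
    have h1 : W1 = 0 := by simpa [hzc] using congrArg Complex.re h
    have h0 : W0 = 0 := by simpa [hzc] using congrArg Complex.im h
    apply htw
    rw [h0, h1, mul_zero, mul_zero, sub_zero]
  set g : ℝ := ‖zc‖ with hg
  have hgpos : 0 < g := norm_pos_iff.mpr hz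
  have hg2 : g ^ 2 = W1 ^ 2 + W0 ^ 2 := by
    rw [hg, Complex.sq_norm, Complex.normSq_apply]; ring
  set θ : ℝ := Complex.arg zc with hθ
  have hcos : Real.cos θ = W1 / g := by rw [hθ, Complex.cos_arg hz]
  have hsin : Real.sin θ = W0 / g := by rw [hθ, Complex.sin_arg]
  have pyth : Real.cos θ ^ 2 + Real.sin θ ^ 2 = 1 := Real.cos_sq_add_sin_sq θ
  -- the rotated datum
  set u' : ℝ → EuclideanSpace ℝ (Fin 3) → EuclideanSpace ℝ (Fin 3) := fun s z => rotZ θ (u s (rotZ (-θ) z)) with hu'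
  set U' : Set (ℝ × EuclideanSpace ℝ (Fin 3)) :=
    {p | ((p.1, rotZ (-θ) p.2) : ℝ × EuclideanSpace ℝ (Fin 3)) ∈ U} with hU'
  have hτc : Continuous (fun p : ℝ × EuclideanSpace ℝ (Fin 3) =>
      ((p.1, rotZ (-θ) p.2) : ℝ × EuclideanSpace ℝ (Fin 3))) :=
    continuous_fst.prodMk ((rotZL (-θ)).continuous.comp continuous_snd)
  have hτa : ∀ p : ℝ × EuclideanSpace ℝ (Fin 3), AnalyticAt ℝ (fun p : ℝ × EuclideanSpace ℝ (Fin 3) =>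
      ((p.1, rotZ (-θ) p.2) : ℝ × EuclideanSpace ℝ (Fin 3))) p := fun p =>
    analyticAt_fst.prod (((rotZL (-θ)).analyticAt _).comp analyticAt_snd)
  have hU'o : IsOpen U' := hU.preimage hτc
  have hx₀ : rotZ (-θ) (rotZ θ x₀) = x₀ := rotZ_neg_apply_rotZ θ x₀
  have hp₀' : ((t₀, rotZ θ x₀) : ℝ × EuclideanSpace ℝ (Fin 3)) ∈ U' := by
    show ((t₀, rotZ (-θ) (rotZ θ x₀)) : ℝ × EuclideanSpace ℝ (Fin 3)) ∈ U
    rw [hx₀]; exact hp₀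
  -- analyticity of the rotated datum
  have hu'a : AnalyticOnNhd ℝ (uncurry u') U' := by
    intro p hp
    have h := ((rotZL θ).analyticAt _).comp
      (AnalyticAt.comp (g := uncurry u)
        (f := fun p : ℝ × EuclideanSpace ℝ (Fin 3) => ((p.1, rotZ (-θ) p.2) : ℝ × EuclideanSpace ℝ (Fin 3)))
        (hu _ hp) (hτa p))
    refine h.congr (Eventually.of_forall fun q => ?_)
    obtain ⟨s, z⟩ := q; rfl
  have hμ'a : ∀ p ∈ U', AnalyticAt ℝ (uncurry μ) (p.1, p.2 2) := fun p hp => by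
    have h := hμ _ hp; rwa [rotZ_apply_two] at h
  have hA'a : ∀ p ∈ U', AnalyticAt ℝ (uncurry A) (p.1, p.2 2) := fun p hp => by
    have h := hA _ hp; rwa [rotZ_apply_two] at h
  -- first derivatives of the rotated field
  have hD0 : ∀ (t : ℝ) (y : EuclideanSpace ℝ (Fin 3)), fderiv ℝ (u' t) y (EuclideanSpace.single 0 1) =
      rotZ θ (Real.cos θ • fderiv ℝ (u t) (rotZ (-θ) y) (EuclideanSpace.single 0 1) -
        Real.sin θ • fderiv ℝ (u t) (rotZ (-θ) y) (EuclideanSpace.single 1 1)) := fun t y => by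
    rw [hu']; exact fderiv_rotConj_single_zero (u t) θ y
  have hD1 : ∀ (t : ℝ) (y : EuclideanSpace ℝ (Fin 3)), fderiv ℝ (u' t) y (EuclideanSpace.single 1 1) =
      rotZ θ (Real.sin θ • fderiv ℝ (u t) (rotZ (-θ) y) (EuclideanSpace.single 0 1) +
        Real.cos θ • fderiv ℝ (u t) (rotZ (-θ) y) (EuclideanSpace.single 1 1)) := fun t y => by
    rw [hu']; exact fderiv_rotConj_single_one (u t) θ y
  have hD2 : ∀ (t : ℝ) (y : EuclideanSpace ℝ (Fin 3)), fderiv ℝ (u' t) y (EuclideanSpace.single 2 1) =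
      rotZ θ (fderiv ℝ (u t) (rotZ (-θ) y) (EuclideanSpace.single 2 1)) := fun t y => by
    rw [hu']; exact fderiv_rotConj_single_two (u t) θ y
  -- the kinematic identities transfer
  have hpol' : ∀ p ∈ U', fderiv ℝ (u' p.1) p.2 (EuclideanSpace.single 0 1) 1 =
      fderiv ℝ (u' p.1) p.2 (EuclideanSpace.single 1 1) 0 := by
    intro p hp
    have h := hpol _ hp
    dsimp only at h
    rw [hD0, hD1]
    simp only [rotZ_apply_zero, rotZ_apply_one, PiLp.sub_apply, PiLp.add_apply, PiLp.smul_apply, smul_eq_mul]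
    linear_combination (Real.cos θ ^ 2 + Real.sin θ ^ 2) * h
  have hdiv' : ∀ p ∈ U', fderiv ℝ (u' p.1) p.2 (EuclideanSpace.single 0 1) 0 +
      fderiv ℝ (u' p.1) p.2 (EuclideanSpace.single 1 1) 1 + fderiv ℝ (u' p.1) p.2 (EuclideanSpace.single 2 1) 2 = 0 := by
    intro p hp
    have h := hdiv _ hp
    dsimp only at h
    rw [hD0, hD1, hD2]
    simp only [rotZ_apply_zero, rotZ_apply_one, rotZ_apply_two, PiLp.sub_apply, PiLp.add_apply, PiLp.smul_apply,
      smul_eq_mul]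
    linear_combination h + (fderiv ℝ (u p.1) (rotZ (-θ) p.2) (EuclideanSpace.single 0 1) 0 +
      fderiv ℝ (u p.1) (rotZ (-θ) p.2) (EuclideanSpace.single 1 1) 1) * pyth
  have hsh0' : ∀ p ∈ U', fderiv ℝ (u' p.1) p.2 (EuclideanSpace.single 2 1) 0 =
      μ p.1 (p.2 2) * fderiv ℝ (u' p.1) p.2 (EuclideanSpace.single 0 1) 2 := by
    intro p hp
    have h0 := hsh _ hp 0 (by decide)
    have h1 := hsh _ hp 1 (by decide)
    dsimp only at h0 h1
    rw [rotZ_apply_two] at h0 h1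
    rw [hD2, hD0]
    simp only [rotZ_apply_zero, rotZ_apply_two, PiLp.sub_apply, PiLp.smul_apply, smul_eq_mul]
    rw [h0, h1]; ring
  have hsh1' : ∀ p ∈ U', fderiv ℝ (u' p.1) p.2 (EuclideanSpace.single 2 1) 1 =
      μ p.1 (p.2 2) * fderiv ℝ (u' p.1) p.2 (EuclideanSpace.single 1 1) 2 := by
    intro p hp
    have h0 := hsh _ hp 0 (by decide)
    have h1 := hsh _ hp 1 (by decide)
    dsimp only at h0 h1
    rw [rotZ_apply_two] at h0 h1
    rw [hD2, hD1]
    simp only [rotZ_apply_one, rotZ_apply_two, PiLp.add_apply, PiLp.smul_apply, smul_eq_mul]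
    rw [h0, h1]; ring
  have hsh' : ∀ p ∈ U', ∀ b : Fin 3, b ≠ 2 → fderiv ℝ (u' p.1) p.2 (EuclideanSpace.single 2 1) b =
      μ p.1 (p.2 2) * fderiv ℝ (u' p.1) p.2 (EuclideanSpace.single b 1) 2 := by
    intro p hp b hb
    fin_cases b
    · exact hsh0' p hp
    · exact hsh1' p hp
    · exact absurd rfl hb
  -- the scalar law transfers by rotation covariance
  have hE' : ∀ p ∈ U',
      (1 - μ p.1 (p.2 2)) *
          (deriv (fun s => u' s p.2 2) p.1 + fderiv ℝ (fun y => u' p.1 y 2) p.2 (u' p.1 p.2)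
            - Δ (fun y => u' p.1 y 2) p.2) =
        A p.1 (p.2 2) + (deriv (fun s => μ s (p.2 2)) p.1 - deriv (deriv (μ p.1)) (p.2 2)) * u' p.1 p.2 2
          + deriv (μ p.1) (p.2 2) / 2 * u' p.1 p.2 2 ^ 2
          - 2 * deriv (μ p.1) (p.2 2) * fderiv ℝ (u' p.1) p.2 (EuclideanSpace.single 2 1) 2 := by
    intro p hp
    obtain ⟨t, y⟩ := p
    have hq : ((t, rotZ (-θ) y) : ℝ × EuclideanSpace ℝ (Fin 3)) ∈ U := hp
    have h := hE _ hq
    dsimp only at h ⊢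
    rw [rotZ_apply_two] at h
    have e1 : (fun s => u' s y 2) = fun s => u s (rotZ (-θ) y) 2 := by funext s; simp [hu']
    have e2 : (fun z => u' t z 2) = fun z => (fun x => u t x 2) (rotZ (-θ) z) := by funext z; simp [hu']
    have e3 : u' t y 2 = u t (rotZ (-θ) y) 2 := by simp [hu']
    have e4 : fderiv ℝ (fun z => (fun x => u t x 2) (rotZ (-θ) z)) y (u' t y) =
        fderiv ℝ (fun x => u t x 2) (rotZ (-θ) y) (u t (rotZ (-θ) y)) := by
      rw [fderiv_comp_rotZ_neg (g := fun x => u t x 2), hu']; dsimp only; rw [rotZ_neg_apply_rotZ]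
    rw [e1, e2, e3, e4, laplacian_comp_rotZ_neg (g := fun x => u t x 2), hD2, rotZ_apply_two]
    exact h
  -- the pins at `p₀′ = (t₀, R_θ x₀)`
  have hG : ∀ e : EuclideanSpace ℝ (Fin 3),
      fderiv ℝ (fun y => fderiv ℝ (u' t₀) y (EuclideanSpace.single 2 1) 2) (rotZ θ x₀) e =
        fderiv ℝ (fun y => fderiv ℝ (u t₀) y (EuclideanSpace.single 2 1) 2) x₀ (rotZ (-θ) e) := fun e => by
    have hfun : (fun y => fderiv ℝ (u' t₀) y (EuclideanSpace.single 2 1) 2) =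
        fun z => (fun x => fderiv ℝ (u t₀) x (EuclideanSpace.single 2 1) 2) (rotZ (-θ) z) := by
      rw [hu']; exact fderiv_rotConj_vertShear (u t₀) θ
    rw [hfun, fderiv_comp_rotZ_neg (g := fun x => fderiv ℝ (u t₀) x (EuclideanSpace.single 2 1) 2), hx₀]
  have hW' : ∀ e : EuclideanSpace ℝ (Fin 3), fderiv ℝ (u' t₀) (rotZ θ x₀) e 2 =
      fderiv ℝ (u t₀) x₀ (rotZ (-θ) e) 2 := fun e => by
    rw [hu']; dsimp only; rw [fderiv_rotConj, rotZ_apply_two, hx₀]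
  have hW'0 : fderiv ℝ (u' t₀) (rotZ θ x₀) (EuclideanSpace.single 0 1) 2 = 0 := by
    rw [hW', rotZ_neg_single_zero, map_sub, map_smul, map_smul, PiLp.sub_apply, PiLp.smul_apply, PiLp.smul_apply,
      smul_eq_mul, smul_eq_mul, ← hW0, ← hW1, hcos, hsin]
    field_simp
    ring
  have hW'1 : fderiv ℝ (u' t₀) (rotZ θ x₀) (EuclideanSpace.single 1 1) 2 = g := by
    rw [hW', rotZ_neg_single_one, map_add, map_smul, map_smul, PiLp.add_apply, PiLp.smul_apply, PiLp.smul_apply,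
      smul_eq_mul, smul_eq_mul, ← hW0, ← hW1, hcos, hsin]
    field_simp
    nlinarith [hg2]
  -- the source-free datum is unchanged by the rotation (μ, A unchanged; the rotation fixes the height)
  have hSF' : ∃ k : ℝ, ∀ p ∈ U', A p.1 (p.2 2) =
      k * (deriv (fun s => μ s (p.2 2)) p.1 - deriv (deriv (μ p.1)) (p.2 2)) - k ^ 2 / 2 * deriv (μ p.1) (p.2 2) := by
    obtain ⟨k, hk⟩ := hSF
    refine ⟨k, fun p hp => ?_⟩
    have h := hk _ hp
    dsimp only at h
    rwa [rotZ_apply_two] at h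
  refine hR u' μ A U' (t₀, rotZ θ x₀) hU'o hp₀' hu'a hμ'a hA'a hpol' hdiv' hsh' hE' ?_ ?_ ?_ ?_ ?_ hSF' ?_ ?_ hW'0 ?_
  · -- twist: an `SO(2)` invariant
    dsimp only
    rw [hG, hG, hW', hW', rotZ_neg_single_zero, rotZ_neg_single_one]
    simp only [map_sub, map_add, map_smul, PiLp.sub_apply, PiLp.add_apply, PiLp.smul_apply, smul_eq_mul]
    rw [← hW0, ← hW1]
    intro h
    apply htw
    linear_combination h -
      (fderiv ℝ (fun y => fderiv ℝ (u t₀) y (EuclideanSpace.single 2 1) 2) x₀ (EuclideanSpace.single 0 1) * W1 -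
        fderiv ℝ (fun y => fderiv ℝ (u t₀) y (EuclideanSpace.single 2 1) 2) x₀ (EuclideanSpace.single 1 1) * W0) * pyth
  · dsimp only; rw [rotZ_apply_two]; exact hm0
  · dsimp only; rw [rotZ_apply_two]; exact hm1
  · dsimp only; rw [rotZ_apply_two]; exact hmz
  · dsimp only; rw [rotZ_apply_two]; exact hneg
  · -- the non-umbilic pin: the traceless horizontal strain is rotated by `2θ`
    dsimp only
    rw [hD0, hD1, hx₀]
    simp only [rotZ_apply_zero, rotZ_apply_one, PiLp.sub_apply, PiLp.add_apply, PiLp.smul_apply, smul_eq_mul]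
    have hp := hpol _ hp₀
    dsimp only at hp
    rw [hp]
    set a : ℝ := fderiv ℝ (u t₀) x₀ (EuclideanSpace.single 0 1) 0 with ha
    set b : ℝ := fderiv ℝ (u t₀) x₀ (EuclideanSpace.single 1 1) 0 with hb
    set d : ℝ := fderiv ℝ (u t₀) x₀ (EuclideanSpace.single 1 1) 1 with hd
    by_contra hcon
    simp only [not_or, ne_eq, not_not] at hcon
    obtain ⟨h1, h2⟩ := hcon
    have key : (a - d) ^ 2 + (2 * b) ^ 2 = 0 := by
      have e : (a - d) ^ 2 + (2 * b) ^ 2 =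
          (Real.cos θ * (Real.cos θ * a - Real.sin θ * b) - Real.sin θ * (Real.cos θ * b - Real.sin θ * d) -
              (Real.sin θ * (Real.sin θ * a + Real.cos θ * b) + Real.cos θ * (Real.sin θ * b + Real.cos θ * d))) ^ 2 +
            (2 * (Real.cos θ * (Real.sin θ * a + Real.cos θ * b) - Real.sin θ * (Real.sin θ * b + Real.cos θ * d))) ^ 2 := by
        linear_combination (-(Real.cos θ ^ 2 + Real.sin θ ^ 2 + 1) * ((a - d) ^ 2 + (2 * b) ^ 2)) * pyth
      rw [e, h1, h2]; ring
    have h3 : (a - d) ^ 2 = 0 := by linarith [sq_nonneg (a - d), sq_nonneg (2 * b)]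
    have h4 : (2 * b) ^ 2 = 0 := by linarith [sq_nonneg (a - d), sq_nonneg (2 * b)]
    rw [pow_eq_zero_iff two_ne_zero] at h3 h4
    rcases hNU with hne | hne
    · exact hne (by linarith)
    · exact hne (by linarith)
  · -- rest point
    dsimp only; rw [hu']; dsimp only; rw [hx₀, hrest]; ext i; fin_cases i <;> simp
  · rw [hW'1]; exact hgpos

end Summit.NavierStokesRegularity.NavierStokesRegularity.Theorems.PoloidalWindowDoorLrcModEntireTwistingTHSparseNormalFormR

end
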